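import Literature.Probability.RandomPlanarGeometry.SAWCountMonotoneOdd
import Literature.Probability.RandomPlanarGeometry.SAWCountMonotoneBothTrappedEven
import HarnessLib

/-!
# Monotonicity `cₙ ≤ cₙ₊₁` (O'Brien 1990) for every EVEN `n ≤ 8d - 6`, in every dimension: the escape
# residual is empty there (straight-ray blocking)

Sequel of `SAWCountMonotoneEscape.lean` (`cₙ ≤ cₙ₊₁ + #R`, `R = escapeResidual d n` = the `n`-step
self-avoiding walks on `ℤ^d` with a DOOMED end — no escape route — and a completely surrounded start)
and of `SAWCountMonotoneBothTrappedEven.lean` (no walk trapped at BOTH ends at an even `n ≤ 8d - 6`).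
Here the remaining, pocketed class is excluded as well, so that `R(d, n) = ∅` and O'Brien's
inequality holds at every even `n ≤ 8d - 6` — two steps beyond the reversal route's `8d - 8`
(`SAWCountMonotoneEven.lean`); the bound is sharp for the escape route, since
`SAWCountMonotoneEscapeSharpEven.lean` has residual walks at every even `n ≥ 8d - 4`.

The argument.  Let `ω ∈ R(d, n)`, `n` even, `e = ω n`, `a = extCount ω n` the number of free
neighbours of `e`.
* COUNT.  The `2d` neighbours of `0` (all visited) and the `2d - a` visited neighbours of `e` are odd
  sites, i.e. among the `n/2 ≤ 4d - 3` sites at odd times; they share `c ≤ 2` sites.  With `s` the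
  number of the other («spare») odd sites, `4d - a - c + s ≤ 4d - 3`, i.e. **`a ≥ s + 3 - c`**.
* RAYS.  For a free neighbour `y = e + g`, the straight ray `e + t g`, `t ≥ 2`, carries a walk site
  (else `y, e + 2g, e + 3g, …` is an escape route: `endFree_of_ray_free`, `exists_ray_blocker`).
  Call the direction COSTLESS if some `e + t g`, `t ≥ 2`, has `‖·‖₁ ≤ 2`, COSTLY otherwise.
* COSTLY directions consume spare odd sites, injectively: a blocker `w = e + t g = ω j` has
  `‖w‖₁ ≥ 3`, so `w ≠ 0`, `w ≁ 0`; if `t` is odd, `w` is an odd site not adjacent to `0` or `e` — a spare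
  site ON the ray; if `t` is even, `0 < j < n` and `ω (j ± 1)` are two odd sites adjacent to `w`, not
  both adjacent to `0` (else `w = u + v`, `‖w‖₁ ≤ 2`) and neither adjacent to `e` (a common neighbour of
  `e` and `e + t g` forces `t = 2` and is `y`, which is free) — a spare site NEXT TO the ray.  Ray
  points `e + t g`, `e + t' g'` of different directions are `t + t' ≥ 4` apart
  (`normOne_smul_single_sub_smul_single`), so the spare sites so obtained are distinct
  (`ray_witness_separate`).  Hence `#costly ≤ s`.
* COSTLESS directions are inward along a heavy coordinate: `‖e + t g‖₁ ≤ 2` with `t ≥ 2` forces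
  `g = -sgn(eᵢ) eᵢ` with `|eᵢ| ≥ max (2, ‖e‖₁ - 2)` and (as `y = e + g ∉ N(0) ∪ {0}`) `‖e‖₁ ≥ 3`; at most
  two coordinates are that heavy.  Hence `#costless ≤ 2`, and `= 0` when `‖e‖₁ ≤ 2`.
* END.  If `‖e‖₁ ≥ 3` then `c = 0` and `a ≤ s + 2 < s + 3 ≤ a`; if `‖e‖₁ ≤ 2` then `a ≤ s < s + 1 ≤ a`.

* `endFree_of_ray_free`, `exists_ray_blocker` : a doomed end blocks every straight ray;
* `normOne_smul_single_sub_smul_single`, `ray_witness_separate` : lattice arithmetic of rays;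
* `escapeResidual_eq_empty_of_even` : **`R(d, n) = ∅` for every even `n` with `n + 6 ≤ 8d`**;
* `count_le_count_succ_of_even_le` : **`cₙ ≤ cₙ₊₁` for every even `n ≤ 8d - 6`, every `d`**
  (`d = 3`: `n = 18`; `d = 4`: `n = 26` — beyond the tree's `n ≤ 6d - 4`, even `n ≤ 8d - 8`);
* `count_le_count_succ_even_threshold` : the case `n + 6 = 8d`.

Exhaustive enumeration (lane «pcv-sawmu» a-p4 g26, kit j306921 / j307755 / j307756; not used in any
proof) agrees: `R(2, 10) = R(3, 16) = R(3, 18) = ∅`, `R(4, n) = ∅` for `n ≤ 21`.  The escape route and the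
ray count are a lane construction; the vocabulary is Madras–Slade §1.1–1.2; the general inequality is
O'Brien's theorem, the tree's named fact `BDGS2012_count_mono`.

[cite: MadrasSlade1993, §1.1; §1.2 (p. 10: parity); §7.1 p. 231 (`c_{N+1} ≥ c_N`, O'Brien)]
[cite: BDGS2012, §1.1, eq. (1.1) (`‖x‖₁`); §1.3 (`cₙ ≤ cₙ₊₁`, O'Brien 1990)]
-/

noncomputable section

open Literature.Probability.LatticeModels Literature.Probability.Percolation SimpleGraph

namespace Literature.Probability.RandomPlanarGeometry.SAW.Zd

variable {d : ℕ}

/-! ### Straight escape rays -/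

/-- **The straight ray behind a free neighbour.** If `y` is a free neighbour of the end `e = ω n` and
no site `e + t (y - e)` with `t ≥ 2` is on the walk, then `k ↦ e + (k + 1)(y - e)` is an escape route:
the end is free. [cite: MadrasSlade1993, §1.1] -/
theorem endFree_of_ray_free {ω : ℕ → Site d} {n : ℕ} {y : Site d} (hy : y ∈ freeNbrs ω n)
    (hray : ∀ t : ℕ, 2 ≤ t → ∀ i ≤ n, ω i ≠ ω n + (t : ℤ) • (y - ω n)) : EndFree ω n := by
  obtain ⟨hadj, hfree⟩ := mem_freeNbrs.1 hy
  have hg0 : y - ω n ≠ 0 := sub_ne_zero.2 hadj.ne'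
  refine ⟨fun k => ω n + ((k : ℤ) + 1) • (y - ω n), ?_, ?_, ?_, ?_⟩
  · show (zdGraph d).Adj (ω n) (ω n + (((0 : ℕ) : ℤ) + 1) • (y - ω n))
    simpa using hadj
  · intro k
    have h := (zdGraph_adj_add_right (ω n) y (((k : ℤ) + 1) • (y - ω n))).2 hadj
    have e1 : y + ((k : ℤ) + 1) • (y - ω n) = ω n + (((k + 1 : ℕ) : ℤ) + 1) • (y - ω n) := by
      push_cast; module
    rwa [e1] at h
  · intro k k' h
    have h1 : ((k : ℤ) + 1) • (y - ω n) = ((k' : ℤ) + 1) • (y - ω n) := add_left_cancel h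
    rw [← sub_eq_zero, ← sub_smul, smul_eq_zero] at h1
    rcases h1 with h1 | h1
    · exact_mod_cast (show (k : ℤ) = k' by linarith)
    · exact absurd h1 hg0
  · intro k j hj h
    rcases Nat.eq_zero_or_pos k with rfl | hk
    · refine hfree j hj ?_
      rw [← h]; simp
    · refine hray (k + 1) (by omega) j hj ?_
      rw [← h]; push_cast; rfl

/-- **A doomed end blocks every straight ray**: if the end of `ω` is not free and `y` is a free
neighbour of `e = ω n`, some site `e + t (y - e)` with `t ≥ 2` is on the walk. [cite: MadrasSlade1993, §1.1] -/
theorem exists_ray_blocker {ω : ℕ → Site d} {n : ℕ} {y : Site d} (hdoom : ¬ EndFree ω n)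
    (hy : y ∈ freeNbrs ω n) : ∃ t : ℕ, 2 ≤ t ∧ ∃ i ≤ n, ω i = ω n + (t : ℤ) • (y - ω n) := by
  by_contra h
  push Not at h
  exact hdoom (endFree_of_ray_free hy fun t ht i hi => h t ht i hi)

/-! ### Lattice arithmetic of rays -/

/-- A neighbour `y` of `e` is `e + σ eᵢ` with `σ = ± 1`. [cite: MadrasSlade1993, §1.1] -/
theorem exists_eq_add_single_of_adj {e y : Site d} (h : (zdGraph d).Adj e y) :
    ∃ i : Fin d, ∃ σ : ℤ, (σ = 1 ∨ σ = -1) ∧ y - e = Pi.single i σ := by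
  obtain ⟨i, hi | hi⟩ := (zdGraph_adj_iff_sub e y).1 h
  · exact ⟨i, 1, Or.inl rfl, hi⟩
  · refine ⟨i, -1, Or.inr rfl, ?_⟩
    rw [← neg_sub, hi, ← Pi.single_neg]

/-- `‖t σ eᵢ‖₁ = t` for `σ = ± 1`. [cite: BDGS2012, §1.1, eq. (1.1)] -/
theorem normOne_natCast_smul_single {i : Fin d} {σ : ℤ} (hσ : σ = 1 ∨ σ = -1) (t : ℕ) :
    normOne ((t : ℤ) • (Pi.single i σ : Site d)) = t := by
  rw [← Pi.single_smul, normOne_single, smul_eq_mul]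
  rcases hσ with rfl | rfl <;> simp

/-- **Points on two different rays from `e` are far apart**: for distinct unit steps `σ eᵢ ≠ σ' eᵢ'`
and `t, t' ∈ ℕ`, `‖t σ eᵢ - t' σ' eᵢ'‖₁ = t + t'`. [cite: BDGS2012, §1.1, eq. (1.1)] -/
theorem normOne_smul_single_sub_smul_single {i i' : Fin d} {σ σ' : ℤ} (hσ : σ = 1 ∨ σ = -1)
    (hσ' : σ' = 1 ∨ σ' = -1) (hne : (Pi.single i σ : Site d) ≠ Pi.single i' σ') (t t' : ℕ) :
    normOne ((t : ℤ) • (Pi.single i σ : Site d) - (t' : ℤ) • Pi.single i' σ') = t + t' := by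
  by_cases hii : i = i'
  · subst hii
    have hs : σ' = -σ := by
      rcases hσ with rfl | rfl <;> rcases hσ' with rfl | rfl <;> simp_all
    rw [hs, Pi.single_neg, smul_neg, sub_neg_eq_add, ← add_smul, ← Nat.cast_add,
      normOne_natCast_smul_single hσ]
  · -- different axes: the two coordinates carry `t` and `t'`
    set v₁ : Site d := (t : ℤ) • Pi.single i σ with hv₁
    set v : Site d := v₁ - (t' : ℤ) • Pi.single i' σ' with hv
    have hagree : ∀ k, k ≠ i' → v k = v₁ k := by
      intro k hk
      simp [hv, Pi.sub_apply, Pi.single_eq_of_ne hk]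
    have h := normOne_add_natAbs_eq (e := v₁) (x := v) hagree
    have hv₁i' : v₁ i' = 0 := by simp [hv₁, Pi.single_eq_of_ne (Ne.symm hii)]
    have hvi' : (v i').natAbs = t' := by
      simp only [hv, hv₁, Pi.sub_apply, Pi.smul_apply, Pi.single_eq_same,
        Pi.single_eq_of_ne (Ne.symm hii), smul_eq_mul, mul_zero, zero_sub, Int.natAbs_neg,
        Int.natAbs_mul, Int.natAbs_natCast]
      rcases hσ' with rfl | rfl <;> simp
    have hn₁ : normOne v₁ = t := by rw [hv₁]; exact normOne_natCast_smul_single hσ t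
    rw [hv₁i', Int.natAbs_zero, add_zero, hvi', hn₁] at h
    exact h


/-- The coordinate sum along a ray: `Σₖ (e + t σ eᵢ)ₖ = Σₖ eₖ + t σ`. [cite: BDGS2012, §1.1, eq. (1.1)] -/
theorem sum_apply_add_smul_single (e : Site d) (i : Fin d) (σ : ℤ) (t : ℕ) :
    (∑ k, (e + (t : ℤ) • (Pi.single i σ : Site d)) k) = (∑ k, e k) + t * σ := by
  simp only [Pi.add_apply, Pi.smul_apply, Finset.sum_add_distrib, smul_eq_mul, ← Finset.mul_sum,
    Finset.sum_pi_single', Finset.mem_univ, if_true]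

/-- **Witnesses on different rays are distinct**: a site that lies on, or next to, the ray point
`e + t σ eᵢ` (`t ≥ 2`) does not lie on or next to `e + t' σ' eᵢ'` (`t' ≥ 2`) for a different unit step.
[cite: BDGS2012, §1.1, eq. (1.1)] -/
theorem ray_witness_separate {e x : Site d} {i i' : Fin d} {σ σ' : ℤ} (hσ : σ = 1 ∨ σ = -1)
    (hσ' : σ' = 1 ∨ σ' = -1) (hne : (Pi.single i σ : Site d) ≠ Pi.single i' σ') {t t' : ℕ}
    (ht : 2 ≤ t) (ht' : 2 ≤ t')
    (h : x = e + (t : ℤ) • Pi.single i σ ∨ (zdGraph d).Adj x (e + (t : ℤ) • Pi.single i σ))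
    (h' : x = e + (t' : ℤ) • Pi.single i' σ' ∨ (zdGraph d).Adj x (e + (t' : ℤ) • Pi.single i' σ')) :
    False := by
  set p : Site d := e + (t : ℤ) • Pi.single i σ with hp
  set p' : Site d := e + (t' : ℤ) • Pi.single i' σ' with hp'
  have hdist : normOne (p - p') = t + t' := by
    rw [hp, hp', add_sub_add_left_eq_sub]
    exact normOne_smul_single_sub_smul_single hσ hσ' hne t t'
  have hle : normOne (p - p') ≤ 2 := by
    rcases h with rfl | h <;> rcases h' with h' | h'
    · rw [← h', sub_self, normOne_zero]; omega
    · rw [← neg_sub, normOne_neg, normOne_sub_eq_one_of_adj h']; omega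
    · subst h'; rw [normOne_sub_eq_one_of_adj h]; omega
    · have e1 : p - p' = (p - x) + (x - p') := by abel
      rw [e1]
      refine (normOne_add_le _ _).trans ?_
      rw [normOne_sub_eq_one_of_adj h, ← neg_sub, normOne_neg, normOne_sub_eq_one_of_adj h']
  omega

/-! ### The escape residual is empty at every even length `n ≤ 8d - 6` -/

open Classical in
/-- **`R(d, n) = ∅` for every even `n ≤ 8d - 6`, in every dimension.**  See the module docstring: the
odd count (`2d` start neighbours and `2d - a` visited end neighbours at the `n/2` odd times, `c ≤ 2`
common) gives `a ≥ s + 3 - c` free end neighbours, `s` the number of spare odd sites; every free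
direction has its straight ray blocked (`exists_ray_blocker`), and the blocker hands an injective
spare odd site to every free direction except the at most two «inward» ones (none when `‖e‖₁ ≤ 2`,
and `c = 0` when `‖e‖₁ ≥ 3`). [cite: MadrasSlade1993, §1.2, p. 10; §7.1] [cite: BDGS2012, §1.3] -/
theorem escapeResidual_eq_empty_of_even {n : ℕ} (hev : Even n) (hn : n + 6 ≤ 8 * d) :
    escapeResidual d n = ∅ := by
  classical
  refine Finset.eq_empty_of_forall_notMem fun ω hωR => ?_
  obtain ⟨hω, hdoom, hb⟩ := mem_escapeResidual.1 hωR
  obtain ⟨h00, -, hadj, hinj⟩ := mem_saws.1 hω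
  have hn2 : n % 2 = 0 := Nat.even_iff.1 hev
  have hinj' : ∀ i ≤ n, ∀ j ≤ n, ω i = ω j → i = j := fun i hi j hj h =>
    hinj (show i ∈ {i | i ≤ n} from hi) (show j ∈ {i | i ≤ n} from hj) h
  have hn1 : 4 * d ≤ n + 1 := four_mul_le_of_extCount_eq_zero (revWalk_mem_saws hω) hb
  set e := ω n with he_def
  have he0 : e ≠ 0 := fun h => by
    have := hinj' n le_rfl 0 (Nat.zero_le n) (h.trans h00.symm); omega
  have hsum := exists_sum_apply_eq_add_two_mul hω
  -- every neighbour of the start is visited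
  have hvis0 : ∀ z, (zdGraph d).Adj 0 z → ∃ j ≤ n, ω j = z := by
    intro z hz
    have hU0 := (card_filter_nbrs_start_le_extCount_revWalk hω).trans hb.le
    by_contra h
    have : 0 < ((nbrs (ω 0)).filter fun z => ∀ i ≤ n, ω i ≠ z).card :=
      Finset.card_pos.2 ⟨z, Finset.mem_filter.2 ⟨mem_nbrs.2 (by rw [h00]; exact hz),
        fun i hi hiz => h ⟨i, hi, hiz⟩⟩⟩
    omega
  -- the odd walk sites `O ⊇ N0 ∪ A`, the spare ones `S`
  set O := ((Finset.range (n + 1)).filter fun j => j % 2 = 1).image ω with hO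
  have hOcard : O.card ≤ n / 2 :=
    Finset.card_image_le.trans (by have := card_filter_range_odd_le (n + 1); omega)
  have hOmem : ∀ j ≤ n, j % 2 = 1 → ω j ∈ O := fun j hj hpar =>
    Finset.mem_image.2 ⟨j, Finset.mem_filter.2 ⟨Finset.mem_range.2 (by omega), hpar⟩, rfl⟩
  set N0 := nbrs (0 : Site d) with hN0
  set A := (nbrs e).filter fun z => z ∈ visited ω n with hA
  have hAcard : A.card + extCount ω n = 2 * d := by
    rw [extCount, freeNbrs, hA, Finset.card_filter_add_card_filter_not, card_nbrs]
  have hN0O : N0 ⊆ O := by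
    intro z hz
    have hz' := mem_nbrs.1 hz
    obtain ⟨j, hj, rfl⟩ := hvis0 z hz'
    have hpar := odd_add_of_adj_apply_apply hω (Nat.zero_le n) hj (by rw [h00]; exact hz')
    exact hOmem j hj (by omega)
  have hAO : A ⊆ O := by
    intro z hz
    obtain ⟨hz, hzv⟩ := Finset.mem_filter.1 hz
    obtain ⟨j, hj, rfl⟩ := mem_visited.1 hzv
    have hpar := odd_add_of_adj_apply hω hj (mem_nbrs.1 hz)
    exact hOmem j hj (by omega)
  have hN0card : N0.card = 2 * d := card_nbrs _
  have hN0norm : ∀ z ∈ N0, normOne z = 1 := fun z hz => adj_zero_iff_normOne_eq_one.1 (mem_nbrs.1 hz)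
  have hc2 : (N0 ∩ A).card ≤ 2 := by
    have hsub : N0 ∩ A ⊆ (nbrs (0 : Site d)).filter
        fun z => (zdGraph d).Adj 0 z ∧ (zdGraph d).Adj z e := by
      intro z hz
      obtain ⟨hz0, hzA⟩ := Finset.mem_inter.1 hz
      exact Finset.mem_filter.2 ⟨hz0, mem_nbrs.1 hz0, (mem_nbrs.1 (Finset.mem_filter.1 hzA).1).symm⟩
    exact (Finset.card_le_card hsub).trans (card_filter_adj_adj_le_two he0.symm _)
  set S := O \ (N0 ∪ A) with hS
  have hScard : S.card + (N0 ∪ A).card = O.card :=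
    Finset.card_sdiff_add_card_eq_card (Finset.union_subset hN0O hAO)
  have hUI := Finset.card_union_add_card_inter N0 A
  -- so far: `S.card + 3 ≤ (N0 ∩ A).card + extCount ω n`
  have hcount : S.card + 3 ≤ (N0 ∩ A).card + extCount ω n := by omega
  have hSmem : ∀ x, x ∈ O → x ∉ N0 → x ∉ A → x ∈ S := fun x h1 h2 h3 =>
    Finset.mem_sdiff.2 ⟨h1, by rw [Finset.mem_union, not_or]; exact ⟨h2, h3⟩⟩
  -- free directions: unit steps, costless (inward) or costly
  set Fr := freeNbrs ω n with hFr
  have hFrE : ∀ y ∈ Fr, (zdGraph d).Adj e y ∧ ∀ i ≤ n, ω i ≠ y := fun y hy => mem_freeNbrs.1 hy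
  set CL : Site d → Prop := fun y => ∃ t : ℕ, 2 ≤ t ∧ normOne (e + (t : ℤ) • (y - e)) ≤ 2 with hCL
  set C := Fr.filter fun y => CL y with hC
  set D := Fr.filter fun y => ¬ CL y with hD
  have hCD : C.card + D.card = extCount ω n := by
    rw [hC, hD, Finset.card_filter_add_card_filter_not, extCount]
  -- (1) costly directions consume distinct spare odd sites
  have hkey : ∀ y ∈ D, ∃ x, x ∈ S ∧ ∃ t : ℕ, 2 ≤ t ∧
      (x = e + (t : ℤ) • (y - e) ∨ (zdGraph d).Adj x (e + (t : ℤ) • (y - e))) := by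
    intro y hyD
    obtain ⟨hy, hncl⟩ := Finset.mem_filter.1 hyD
    obtain ⟨hey, hyfree⟩ := hFrE y hy
    obtain ⟨i, σ, hσ, hg⟩ := exists_eq_add_single_of_adj hey
    obtain ⟨t, ht, j, hj, hw⟩ := exists_ray_blocker hdoom hy
    set w := e + (t : ℤ) • (y - e) with hw_def
    have hw3 : 3 ≤ normOne w := by
      by_contra h
      exact hncl ⟨t, ht, by rw [← hw_def]; omega⟩
    have hwe : normOne (w - e) = t := by
      rw [hw_def, add_sub_cancel_left, hg]; exact normOne_natCast_smul_single hσ t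
    have hj0 : j ≠ 0 := by
      rintro rfl
      rw [h00] at hw
      rw [← hw, normOne_zero] at hw3
      omega
    have hjn : j ≠ n := by
      rintro rfl
      have : normOne (w - e) = 0 := by rw [← hw, sub_self, normOne_zero]
      omega
    -- parity of `j` is that of `t`
    have hpar : (j + t) % 2 = 0 := by
      obtain ⟨m₁, hm₁⟩ := hsum j hj
      obtain ⟨m₂, hm₂⟩ := hsum n le_rfl
      have hs : (∑ k, ω j k) = (∑ k, e k) + t * σ := by
        rw [hw, hw_def, hg]; exact sum_apply_add_smul_single e i σ t
      rw [hm₁, hm₂] at hs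
      rcases hσ with rfl | rfl <;> omega
    have hwN0 : w ∉ N0 := fun h => by have := hN0norm w h; omega
    -- no visited common neighbour of `e` and `w`
    have hnoA : ∀ z ∈ A, ¬ (zdGraph d).Adj z w := by
      intro z hz hzw
      obtain ⟨hze, hzv⟩ := Finset.mem_filter.1 hz
      have hze' := mem_nbrs.1 hze
      -- two steps from `e` to `w`: `t ≤ 2`, so `t = 2` and the common neighbour is `y`
      have ht2 : t ≤ 2 := by
        have e1 : w - e = (w - z) + (z - e) := by abel
        have := normOne_add_le (w - z) (z - e)
        rw [← e1, hwe, normOne_sub_eq_one_of_adj hzw, normOne_sub_eq_one_of_adj hze'] at this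
        omega
      have ht2' : t = 2 := by omega
      have hyw : (zdGraph d).Adj y w := by
        have := (zdGraph_adj_add_right e y (y - e)).2 hey
        rw [show e + (y - e) = y by abel, show y + (y - e) = w by
          rw [hw_def, ht2']; push_cast; module] at this
        exact this
      have hew : e ≠ w := fun h => by
        have : normOne (w - e) = 0 := by rw [← h, sub_self, normOne_zero]
        omega
      rcases eq_or_eq_of_adj_adj hew hey hyw hze' hzw with hzy | hzy
      · obtain ⟨k, hk, hkz⟩ := mem_visited.1 hzv
        exact hyfree k hk (hkz.trans hzy)
      · have : e + w - y = y := by rw [hw_def, ht2']; push_cast; module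
        rw [this] at hzy
        obtain ⟨k, hk, hkz⟩ := mem_visited.1 hzv
        exact hyfree k hk (hkz.trans hzy)
    rcases Nat.even_or_odd t with ⟨r, hr⟩ | ⟨r, hr⟩
    · -- `t` even: `w` sits at an even time `0 < j < n`; its walk-neighbours are odd sites next to `w`
      have hjodd : (j - 1) % 2 = 1 ∧ (j + 1) % 2 = 1 := by omega
      have hjlt : j < n := lt_of_le_of_ne hj hjn
      set u := ω (j - 1) with hu
      set v := ω (j + 1) with hv
      have huO : u ∈ O := hOmem (j - 1) (by omega) hjodd.1
      have hvO : v ∈ O := hOmem (j + 1) (by omega) hjodd.2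
      have huw : (zdGraph d).Adj u w := by
        rw [← hw]; have := hadj (j - 1) (by omega); rwa [show j - 1 + 1 = j by omega] at this
      have hvw : (zdGraph d).Adj v w := by rw [← hw]; exact (hadj j hjlt).symm
      have huv : u ≠ v := fun h => by have := hinj' (j - 1) (by omega) (j + 1) (by omega) h; omega
      have hnot : ¬ (u ∈ N0 ∧ v ∈ N0) := by
        rintro ⟨huN, hvN⟩
        have hu0 := mem_nbrs.1 huN
        have hv0 := mem_nbrs.1 hvN
        rcases eq_or_eq_of_adj_adj huv hu0.symm hv0 huw hvw.symm with h | h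
        · rw [h, normOne_zero] at hw3; omega
        · rw [sub_zero] at h
          have := normOne_add_le u v
          rw [← h, hN0norm u huN, hN0norm v hvN] at this
          omega
      by_cases huN : u ∈ N0
      · have hvN : v ∉ N0 := fun h => hnot ⟨huN, h⟩
        exact ⟨v, hSmem v hvO hvN (fun h => hnoA v h hvw), t, ht, Or.inr hvw⟩
      · exact ⟨u, hSmem u huO huN (fun h => hnoA u h huw), t, ht, Or.inr huw⟩
    · -- `t` odd: `w` itself is an odd site, not next to `0` or `e`
      have hjodd : j % 2 = 1 := by omega
      have hwO : w ∈ O := hw ▸ hOmem j hj hjodd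
      have hwA : w ∉ A := fun h => by
        have := normOne_sub_eq_one_of_adj (mem_nbrs.1 (Finset.mem_filter.1 h).1)
        rw [hwe] at this; omega
      exact ⟨w, hSmem w hwO hwN0 hwA, t, ht, Or.inl rfl⟩
  choose! φ hφS hφt using hkey
  have hDcard : D.card ≤ S.card := by
    refine Finset.card_le_card_of_injOn φ (fun y hy => Finset.mem_coe.2 (hφS y (Finset.mem_coe.1 hy))) ?_
    intro y₁ hy₁ y₂ hy₂ hφ
    rw [Finset.mem_coe] at hy₁ hy₂
    by_contra hne
    obtain ⟨hey₁, -⟩ := hFrE y₁ (Finset.mem_filter.1 hy₁).1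
    obtain ⟨hey₂, -⟩ := hFrE y₂ (Finset.mem_filter.1 hy₂).1
    obtain ⟨i₁, σ₁, hσ₁, hg₁⟩ := exists_eq_add_single_of_adj hey₁
    obtain ⟨i₂, σ₂, hσ₂, hg₂⟩ := exists_eq_add_single_of_adj hey₂
    have hne' : (Pi.single i₁ σ₁ : Site d) ≠ Pi.single i₂ σ₂ := by
      rw [← hg₁, ← hg₂]; exact fun h => hne (sub_left_injective h)
    obtain ⟨t₁, ht₁, h₁⟩ := hφt y₁ hy₁
    obtain ⟨t₂, ht₂, h₂⟩ := hφt y₂ hy₂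
    rw [hg₁] at h₁
    rw [hg₂, ← hφ] at h₂
    exact ray_witness_separate hσ₁ hσ₂ hne' ht₁ ht₂ h₁ h₂
  -- (2) costless directions are inward along a heavy coordinate: at most two, none if `‖e‖₁ ≤ 2`
  have hcl : ∀ y ∈ C, ∃ i : Fin d, ∃ σ : ℤ, (σ = 1 ∨ σ = -1) ∧ y - e = Pi.single i σ ∧
      σ * e i < 0 ∧ 2 ≤ (e i).natAbs ∧ normOne e ≤ 2 + (e i).natAbs ∧ 3 ≤ normOne e := by
    intro y hyC
    obtain ⟨hy, t, ht, hcl⟩ := Finset.mem_filter.1 hyC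
    obtain ⟨hey, hyfree⟩ := hFrE y hy
    obtain ⟨i, σ, hσ, hg⟩ := exists_eq_add_single_of_adj hey
    refine ⟨i, σ, hσ, hg, ?_⟩
    rw [hg] at hcl
    -- the ray point agrees with `e` off `i`
    have hx := normOne_add_natAbs_eq (e := e) (x := e + (t : ℤ) • (Pi.single i σ : Site d)) (i := i)
      (fun k hk => by simp [Pi.single_eq_of_ne hk])
    have hxi : (e + (t : ℤ) • (Pi.single i σ : Site d)) i = e i + t * σ := by simp
    rw [hxi] at hx
    -- `y` agrees with `e` off `i`
    have hyv : y = e + Pi.single i σ := by rw [← hg]; abel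
    have hy' := normOne_add_natAbs_eq (e := e) (x := y) (i := i)
      (fun k hk => by rw [hyv]; simp [Pi.single_eq_of_ne hk])
    have hyi : y i = e i + σ := by rw [hyv]; simp
    rw [hyi] at hy'
    have hy0 : normOne y ≠ 0 := fun h => hyfree 0 (Nat.zero_le n) (h00.trans (normOne_eq_zero_iff.1 h).symm)
    have hy1 : normOne y ≠ 1 := by
      intro h
      obtain ⟨k, hk, hky⟩ := hvis0 y (adj_zero_iff_normOne_eq_one.2 h)
      exact hyfree k hk hky
    have he00 : normOne e ≠ 0 := fun h => he0 (normOne_eq_zero_iff.1 h)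
    rcases hσ with rfl | rfl
    · have hlt : (1 : ℤ) * e i < 0 := by
        by_contra hge
        have : (e i + t * 1).natAbs = (e i).natAbs + t := by omega
        omega
      refine ⟨hlt, ?_, ?_, ?_⟩ <;> omega
    · have hlt : (-1 : ℤ) * e i < 0 := by
        by_contra hge
        have : (e i + t * (-1)).natAbs = (e i).natAbs + t := by omega
        omega
      refine ⟨hlt, ?_, ?_, ?_⟩ <;> omega
  haveI : Nonempty (Fin d) := ⟨⟨0, by omega⟩⟩
  choose! ax sg hsg hax hneg htwo hheavy hthree using hcl
  set I := (Finset.univ : Finset (Fin d)).filter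
    fun i => 2 ≤ (e i).natAbs ∧ normOne e ≤ 2 + (e i).natAbs with hI
  have hCcard : C.card ≤ I.card := by
    refine Finset.card_le_card_of_injOn ax (fun y hy => ?_) ?_
    · have hy := Finset.mem_coe.1 hy
      exact Finset.mem_coe.2 (Finset.mem_filter.2 ⟨Finset.mem_univ _, htwo y hy, hheavy y hy⟩)
    · intro y₁ hy₁ y₂ hy₂ h
      rw [Finset.mem_coe] at hy₁ hy₂
      have h1 := hneg y₁ hy₁
      have h2 := hneg y₂ hy₂
      rw [h] at h1
      have hs : sg y₁ = sg y₂ := by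
        rcases hsg y₁ hy₁ with e1 | e1 <;> rcases hsg y₂ hy₂ with e2 | e2 <;>
          rw [e1] at h1 ⊢ <;> rw [e2] at h2 ⊢ <;> omega
      have := hax y₁ hy₁
      rw [h, hs, ← hax y₂ hy₂] at this
      exact sub_left_injective this
  have hIcard : I.card ≤ 2 := by
    by_contra h3
    have hsumI : ∑ i ∈ I, (e i).natAbs ≤ normOne e :=
      Finset.sum_le_sum_of_subset_of_nonneg (Finset.filter_subset _ _) fun _ _ _ => Nat.zero_le _
    have h2I : I.card • 2 ≤ ∑ i ∈ I, (e i).natAbs :=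
      Finset.card_nsmul_le_sum I _ 2 fun i hi => (Finset.mem_filter.1 hi).2.1
    have hmI : I.card • (normOne e - 2) ≤ ∑ i ∈ I, (e i).natAbs :=
      Finset.card_nsmul_le_sum I _ _ fun i hi => by have := (Finset.mem_filter.1 hi).2.2; omega
    rw [smul_eq_mul] at h2I hmI
    have h3' : 3 ≤ I.card := by omega
    have : 3 * (normOne e - 2) ≤ normOne e :=
      (Nat.mul_le_mul_right _ h3').trans (hmI.trans hsumI)
    have : 3 * 2 ≤ normOne e := (Nat.mul_le_mul_right _ h3').trans (h2I.trans hsumI)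
    omega
  -- (3) conclude
  by_cases hm : 3 ≤ normOne e
  · -- far end: no common neighbour with the start
    have hc0 : (N0 ∩ A).card = 0 := by
      rw [Finset.card_eq_zero, Finset.eq_empty_iff_forall_notMem]
      intro z hz
      obtain ⟨hz0, hzA⟩ := Finset.mem_inter.1 hz
      have h1 := hN0norm z hz0
      rcases normOne_adj_cases (mem_nbrs.1 (Finset.mem_filter.1 hzA).1) with h | h <;> omega
    omega
  · have hC0 : C.card = 0 := by
      rw [Finset.card_eq_zero, Finset.eq_empty_iff_forall_notMem]
      intro y hy
      have := hthree y hy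
      omega
    omega

/-- **`cₙ ≤ cₙ₊₁` for every even `n ≤ 8d - 6`, in every dimension**, by the escape route
`count_le_count_succ_of_escapeResidual_eq_empty` (`d = 3`: the even lengths `n ≤ 18`, i.e. `18` beyond
the tree's `n ≤ 14`, even `n ≤ 16`; `d = 4`: `n = 26`).  The general inequality is O'Brien's theorem,
the tree's named fact `BDGS2012_count_mono`. [cite: BDGS2012, §1.3] [cite: MadrasSlade1993, §7.1] -/
theorem count_le_count_succ_of_even_le {n : ℕ} (hev : Even n) (hn : n + 6 ≤ 8 * d) :
    count d n ≤ count d (n + 1) :=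
  count_le_count_succ_of_escapeResidual_eq_empty (escapeResidual_eq_empty_of_even hev hn)

/-- At the even threshold: **`c₈d₋₆ ≤ c₈d₋₅` for every `d ≥ 1`** (stated with `n + 6 = 8d`; `d = 3`:
`c₁₈ ≤ c₁₉` on `ℤ³`). [cite: BDGS2012, §1.3] -/
theorem count_le_count_succ_even_threshold {n : ℕ} (hn : n + 6 = 8 * d) :
    count d n ≤ count d (n + 1) :=
  count_le_count_succ_of_even_le ⟨4 * d - 3, by omega⟩ hn.le

end Literature.Probability.RandomPlanarGeometry.SAW.Zd
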